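import Summits.QuantumFields.BalabanUV.Beta.GAN24.FibreStepResidues

/-!
# `BalabanUV.Beta.GAN24.FibreSymbolShift` — binder row G-an2-4 / (CONV-C), propagator slot, road P1-fibre, typer row **P1-Y10c** (DAG node N15c), PART 1/2:
# the COMPLEX SHIFT of a Bloch symbol is a BLOCK-CONSTANT WEIGHT CONJUGATION; difference bounds; the first-order conjugation error is ANTI-HERMITIAN
# (input of gan24-p1's L10 `FibreStrip`, «form-version Combes–Thomas + Brezzi, NOT termwise»; PART 2 = `GAN24/FibreSymbolShiftCosh`: the cosh identity)

NOT IN PRINT; OUR PROOF ATTEMPT.  HONEST FRAMING (cell contract, verbatim): «discharging `BetaPertH` makes Bałaban's UV stability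
UNCONDITIONAL — a real constructive-QFT result; it is NOT the continuum limit and NOT the Clay problem.»  HONEST DEPENDENCY (verbatim):
«continuum YM on T⁴ ⇐ BetaPertH ∧ nine spine estimates (0/9 proved); BetaPertH ⇐ (D1) ∧ (D4) ∧ CAP+tail; G-an2-4 gates asym, D1 and
NE2/3/4.»  [folklore] finite algebra over `FibreInverseDecay.trigPolySymbol S L p = Σ_{b ∈ S} cphase b p • L b` for a GENERAL finite index
type `n`, displacement set `S ⊆ ℤ^{d+1}` and matrix coefficients `L`.  Cites nothing, mints no fact (every hypothesis is a displayed binder),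
instantiates NO wall binder, proves NO `j`-uniform estimate.  NOT BetaPertH, NOT continuum, NOT Clay.  (Unit b2b-balaban-gan24-formalise-leaf-01-g5;
row P1-Y10c of `HOME/GAN24/Formal/LEAVES.md` v2.4; patterns `King1986.UniformDecay.form_conj_eq_cosh`, `Beta.DeltaACombesThomas.re_conjugated_form`.)

## What is proved (`F := trigPolySymbol S L`, shift `imShift p η a : μ ↦ p_μ + iη a_μ`, weight `cw η a b = e^{−η a·b}`, `a : Fin (d+1) → ℝ`, `η : ℝ`)
§1 (a) `cphase_imShift`: `cphase b (p + iηa) = e^{−η a·b} · cphase b p`; `trigPolySymbol_imShift`: `F(p + iηa) = Σ_b (e^{−η a·b} cphase b p) • L b` — the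
   complex shift of the momentum IS the conjugation of the block operator by the block-constant weights `e^{η a·y}`; `eq_imShift`: a strip point of
   half-width `κ` is the unit shift of its real part in a direction with `|a_μ| ≤ κ`.
§2 (a) `trigPolySymbol_imShift_sub` / `…_sub_add_firstOrder` with the FIRST-ORDER TERM `firstOrder S L a p = Σ_b (a·b) cphase b p • L b`
   (`F(p+iηa) = F(p) − η F₁(p) + O(η²)`); scalar Taylor bounds `|e^{−ηa·b} − 1| ≤ e^{|η|R} − 1`, `|e^{−ηa·b} − 1 + η a·b| ≤ e^{|η|R} − 1 − |η|R` under the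
   RANGE hypothesis `hR : ∀ b ∈ S, |a·b| ≤ R`.
§3 (a) DIFFERENCE BOUNDS at real momentum: entrywise `‖(F(q+iηa) − F(q)) i j‖ ≤ (e^{|η|R} − 1) Σ_b ‖L b i j‖` + the second-order twin; Euclidean-operator forms
   `‖toEuclideanLin (F(q+iηa) − F(q)) v‖ ≤ (e^{|η|R} − 1)(Σ_b ℓ_b)‖v‖` from `‖toEuclideanLin (L b) v‖ ≤ ℓ_b‖v‖` (the `hH` currency of
   `SaddlePointBound.matrix_apriori`) + the second-order twin with `+ η • F₁` (the `ε_H` input of row P1-Y10p).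
§4 (b) ADJOINTS under `hS : b ∈ S → −b ∈ S`, `hL : L (−b) = (L b)ᴴ`: `(F(q + iηa))ᴴ = F(q − iηa)`, `F(q)` Hermitian, `F₁(q)ᴴ = −F₁(q)`, and
   `re ⟨x, F₁(q) x⟩ = 0` — the first-order conjugation error is invisible in the real part of the form.
(hS) holds for `BlochFibreMatrix.stencil` (`FibreSymbolShiftCosh.neg_mem_stencil`); (hL) is NOT discharged for `BlochFibreMatrix.pieceMatrix` — the typed KKT
block system (EL / G / M / Q rows) is not literally Hermitian (G rows = gauge-quantity DIFFERENCES, M row = a block SUM) — it stays a hypothesis for the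
L10 owner, who applies the identities to the Hermitian field block.
-/

noncomputable section

open Complex Finset Matrix WithLp
open scoped BigOperators InnerProductSpace ComplexConjugate
open Literature.MathematicalPhysics.QuantumFieldTheory
open Literature.MathematicalPhysics.QuantumFieldTheory.Balaban1983to89
open Literature.MathematicalPhysics.QuantumFieldTheory.Balaban1983to89.Beta
open B4Strip (ofRealVec Strip)
open FibreInverseDecay (cphase trigPolySymbol trigPolySymbol_apply)
open BlochFibreMatrix (stencil mem_stencil)
open Summit.QuantumFields.BalabanUV.Beta.GAN24.CombesThomasFibreStep (cphase_add_eq_mul cphase_zero_left)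
open Summit.QuantumFields.BalabanUV.Beta.GAN24.FibreStepResidues (norm_cphase_ofRealVec)

namespace Summit.QuantumFields.BalabanUV.Beta.GAN24.FibreSymbolShift

variable {d : ℕ}

/-! ## §1 The imaginary shift of the momentum is a block-constant weight conjugation -/

/-- [folklore] `a·b` for a real direction `a` and a lattice displacement `b`. -/
def rdot (a : Fin (d + 1) → ℝ) (b : Fin (d + 1) → ℤ) : ℝ := ∑ μ, a μ * (b μ : ℝ)

/-- [folklore] `a·(−b) = −a·b`. -/
theorem rdot_neg (a : Fin (d + 1) → ℝ) (b : Fin (d + 1) → ℤ) : rdot a (-b) = -rdot a b := by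
  unfold rdot
  rw [← Finset.sum_neg_distrib]
  exact Finset.sum_congr rfl fun μ _ => by simp only [Pi.neg_apply, Int.cast_neg]; ring

/-- [folklore] `|a·b| ≤ κ Σ_μ |b_μ|` when `|a_μ| ≤ κ`. -/
theorem abs_rdot_le (a : Fin (d + 1) → ℝ) (b : Fin (d + 1) → ℤ) {κ : ℝ} (ha : ∀ μ, |a μ| ≤ κ) :
    |rdot a b| ≤ κ * ∑ μ, |(b μ : ℝ)| := by
  unfold rdot
  rw [Finset.mul_sum]
  refine (Finset.abs_sum_le_sum_abs _ _).trans (Finset.sum_le_sum fun μ _ => ?_)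
  rw [abs_mul]
  exact mul_le_mul_of_nonneg_right (ha μ) (abs_nonneg _)

/-- [folklore] The shifted momentum `p + iη a`. -/
def imShift (p : Fin (d + 1) → ℂ) (η : ℝ) (a : Fin (d + 1) → ℝ) : Fin (d + 1) → ℂ :=
  fun μ => p μ + I * ((η * a μ : ℝ) : ℂ)

/-- [folklore] unfolding. -/
theorem imShift_apply (p : Fin (d + 1) → ℂ) (η : ℝ) (a : Fin (d + 1) → ℝ) (μ : Fin (d + 1)) :
    imShift p η a μ = p μ + I * ((η * a μ : ℝ) : ℂ) := rfl

/-- [folklore] The zero shift. -/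
theorem imShift_zero (p : Fin (d + 1) → ℂ) (a : Fin (d + 1) → ℝ) : imShift p 0 a = p := by
  funext μ
  simp [imShift]

/-- [folklore] STRIP DECOMPOSITION: every complex momentum is the unit shift of its real part in the direction of its imaginary part,
`p = imShift (ofRealVec (Re p)) 1 (Im p)` — a point of `Strip (d+1) κ` is thus a shift with `|a_μ| ≤ κ`. -/
theorem eq_imShift (p : Fin (d + 1) → ℂ) : p = imShift (ofRealVec fun μ => (p μ).re) 1 (fun μ => (p μ).im) := by
  funext μ
  simp only [imShift, ofRealVec, one_mul]
  rw [mul_comm]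
  exact (Complex.re_add_im (p μ)).symm

/-- [folklore] … and its imaginary part is bounded by the half-width on the strip. -/
theorem abs_im_le_of_mem_Strip {κ : ℝ} {p : Fin (d + 1) → ℂ} (hp : p ∈ Strip (d + 1) κ) (μ : Fin (d + 1)) :
    |(p μ).im| ≤ κ := (hp μ).2

/-- [folklore] The CONJUGATION WEIGHT `e^{−η a·b}`. -/
def cw (η : ℝ) (a : Fin (d + 1) → ℝ) (b : Fin (d + 1) → ℤ) : ℝ := Real.exp (-(η * rdot a b))

/-- [folklore] positivity. -/
theorem cw_pos (η : ℝ) (a : Fin (d + 1) → ℝ) (b : Fin (d + 1) → ℤ) : 0 < cw η a b := Real.exp_pos _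

/-- [folklore] `cw 0 = 1`. -/
theorem cw_zero (a : Fin (d + 1) → ℝ) (b : Fin (d + 1) → ℤ) : cw 0 a b = 1 := by simp [cw]

/-- [folklore] `cw η a (−b) = cw (−η) a b = e^{+η a·b}`. -/
theorem cw_neg_right (η : ℝ) (a : Fin (d + 1) → ℝ) (b : Fin (d + 1) → ℤ) : cw η a (-b) = cw (-η) a b := by
  simp only [cw, rdot_neg]; ring_nf

/-- [folklore] **(a) THE SHIFT IDENTITY**: `cphase b (p + iηa) = e^{−η a·b} · cphase b p`. -/
theorem cphase_imShift (b : Fin (d + 1) → ℤ) (p : Fin (d + 1) → ℂ) (η : ℝ) (a : Fin (d + 1) → ℝ) :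
    cphase b (imShift p η a) = ((cw η a b : ℝ) : ℂ) * cphase b p := by
  unfold cphase cw rdot
  have hsum : ∑ μ, imShift p η a μ * (b μ : ℂ) = (∑ μ, p μ * (b μ : ℂ)) + I * ((η * ∑ μ, a μ * (b μ : ℝ) : ℝ) : ℂ) := by
    rw [Complex.ofReal_mul, Complex.ofReal_sum, Finset.mul_sum, Finset.mul_sum, ← Finset.sum_add_distrib]
    refine Finset.sum_congr rfl fun μ _ => ?_
    rw [imShift_apply]
    push_cast
    ring
  rw [hsum, mul_add, ← mul_assoc, Complex.I_mul_I, neg_one_mul, Complex.exp_add, Complex.ofReal_exp, Complex.ofReal_neg, mul_comm]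

/-- [folklore] **(a) THE SYMBOL AT THE SHIFTED MOMENTUM** `F(p + iηa) = Σ_b (e^{−η a·b} cphase b p) • L b`. -/
theorem trigPolySymbol_imShift {n : Type*} (S : Finset (Fin (d + 1) → ℤ)) (L : (Fin (d + 1) → ℤ) → Matrix n n ℂ)
    (p : Fin (d + 1) → ℂ) (η : ℝ) (a : Fin (d + 1) → ℝ) :
    trigPolySymbol S L (imShift p η a) = ∑ b ∈ S, (((cw η a b : ℝ) : ℂ) * cphase b p) • L b := by
  unfold trigPolySymbol
  exact Finset.sum_congr rfl fun b _ => by rw [cphase_imShift]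

/-! ## §2 Difference identities, the first-order term, scalar Taylor bounds -/

section General

variable {n : Type*} (S : Finset (Fin (d + 1) → ℤ)) (L : (Fin (d + 1) → ℤ) → Matrix n n ℂ)

/-- [folklore] THE FIRST-ORDER TERM `F₁(p) = Σ_b (a·b) cphase b p • L b` (so that `F(p + iηa) = F(p) − η F₁(p) + O(η²)`). -/
def firstOrder (a : Fin (d + 1) → ℝ) (p : Fin (d + 1) → ℂ) : Matrix n n ℂ :=
  ∑ b ∈ S, (((rdot a b : ℝ) : ℂ) * cphase b p) • L b

/-- [folklore] `F(p + iηa) − F(p) = Σ_b ((e^{−ηa·b} − 1) cphase b p) • L b`. -/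
theorem trigPolySymbol_imShift_sub (p : Fin (d + 1) → ℂ) (η : ℝ) (a : Fin (d + 1) → ℝ) :
    trigPolySymbol S L (imShift p η a) - trigPolySymbol S L p = ∑ b ∈ S, (((cw η a b - 1 : ℝ) : ℂ) * cphase b p) • L b := by
  rw [trigPolySymbol_imShift]
  unfold trigPolySymbol
  rw [← Finset.sum_sub_distrib]
  refine Finset.sum_congr rfl fun b _ => ?_
  rw [← sub_smul]
  congr 1
  push_cast
  ring

/-- [folklore] `F(p + iηa) − F(p) + η F₁(p) = Σ_b ((e^{−ηa·b} − 1 + η a·b) cphase b p) • L b` (the second-order remainder). -/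
theorem trigPolySymbol_imShift_sub_add_firstOrder (p : Fin (d + 1) → ℂ) (η : ℝ) (a : Fin (d + 1) → ℝ) :
    trigPolySymbol S L (imShift p η a) - trigPolySymbol S L p + (η : ℂ) • firstOrder S L a p =
      ∑ b ∈ S, (((cw η a b - 1 + η * rdot a b : ℝ) : ℂ) * cphase b p) • L b := by
  rw [trigPolySymbol_imShift_sub, firstOrder, Finset.smul_sum, ← Finset.sum_add_distrib]
  refine Finset.sum_congr rfl fun b _ => ?_
  rw [smul_smul, ← add_smul]
  congr 1
  push_cast
  ring

end General

/-- [folklore] `|e^{t} − 1| ≤ e^{θ} − 1` and `|e^{t} − 1 − t| ≤ e^{θ} − 1 − θ` for `|t| ≤ θ` (Taylor remainders of `exp` with nonnegative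
coefficients; from `Complex.norm_exp_sub_sum_le_exp_norm_sub_sum`). -/
theorem abs_exp_taylor_le {t θ : ℝ} (h : |t| ≤ θ) :
    |Real.exp t - 1| ≤ Real.exp θ - 1 ∧ |Real.exp t - 1 - t| ≤ Real.exp θ - 1 - θ := by
  have h1 := Complex.norm_exp_sub_sum_le_exp_norm_sub_sum (t : ℂ) 1
  have h2 := Complex.norm_exp_sub_sum_le_exp_norm_sub_sum (t : ℂ) 2
  simp only [Finset.sum_range_succ, Finset.sum_range_zero, pow_zero, Nat.factorial_zero, Nat.cast_one, div_one,
    zero_add, pow_one, Nat.factorial_one, Complex.norm_real, Real.norm_eq_abs] at h1 h2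
  have e1 : ‖Complex.exp (t : ℂ) - 1‖ = |Real.exp t - 1| := by
    rw [← Complex.ofReal_exp, ← Complex.ofReal_one, ← Complex.ofReal_sub, Complex.norm_real, Real.norm_eq_abs]
  have e2 : ‖Complex.exp (t : ℂ) - (1 + (t : ℂ))‖ = |Real.exp t - 1 - t| := by
    rw [← Complex.ofReal_exp, ← Complex.ofReal_one, ← Complex.ofReal_add, ← Complex.ofReal_sub, Complex.norm_real,
      Real.norm_eq_abs, sub_add_eq_sub_sub]
  rw [e1] at h1
  rw [e2] at h2
  have hmono : Real.exp |t| ≤ Real.exp θ := Real.exp_le_exp.mpr h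
  -- `u ↦ e^u − 1 − u` is monotone on `u ≥ 0`: `e^θ − e^{|t|} ≥ θ − |t|`
  have hgap : θ - |t| ≤ Real.exp θ - Real.exp |t| := by
    have h0 : 0 ≤ θ - |t| := sub_nonneg.mpr h
    have hexp : Real.exp θ = Real.exp |t| * Real.exp (θ - |t|) := by rw [← Real.exp_add]; ring_nf
    have h3 : θ - |t| + 1 ≤ Real.exp (θ - |t|) := Real.add_one_le_exp _
    have h4 : 1 ≤ Real.exp |t| := Real.one_le_exp (abs_nonneg t)
    rw [hexp]
    nlinarith
  exact ⟨h1.trans (by linarith), h2.trans (by linarith)⟩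

/-- [folklore] `|e^{−ηa·b} − 1| ≤ e^{|η|R} − 1` when `|a·b| ≤ R`. -/
theorem abs_cw_sub_one_le {η R : ℝ} {a : Fin (d + 1) → ℝ} {b : Fin (d + 1) → ℤ} (hR : |rdot a b| ≤ R) :
    |cw η a b - 1| ≤ Real.exp (|η| * R) - 1 := by
  have h : |-(η * rdot a b)| ≤ |η| * R := by
    rw [abs_neg, abs_mul]; exact mul_le_mul_of_nonneg_left hR (abs_nonneg η)
  exact (abs_exp_taylor_le h).1

/-- [folklore] `|e^{−ηa·b} − 1 + η a·b| ≤ e^{|η|R} − 1 − |η|R` when `|a·b| ≤ R`. -/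
theorem abs_cw_sub_one_add_le {η R : ℝ} {a : Fin (d + 1) → ℝ} {b : Fin (d + 1) → ℤ} (hR : |rdot a b| ≤ R) :
    |cw η a b - 1 + η * rdot a b| ≤ Real.exp (|η| * R) - 1 - |η| * R := by
  have h : |-(η * rdot a b)| ≤ |η| * R := by
    rw [abs_neg, abs_mul]; exact mul_le_mul_of_nonneg_left hR (abs_nonneg η)
  have := (abs_exp_taylor_le h).2
  rwa [sub_neg_eq_add] at this

/-! ## §3 Difference bounds: entrywise and in Euclidean operator form -/

section Bounds

variable {n : Type*} (S : Finset (Fin (d + 1) → ℤ)) (L : (Fin (d + 1) → ℤ) → Matrix n n ℂ)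

/-- [folklore] generic entrywise bound for the weighted sums of this file. -/
theorem norm_sum_smul_apply_le (c : (Fin (d + 1) → ℤ) → ℂ) (i j : n) :
    ‖(∑ b ∈ S, c b • L b) i j‖ ≤ ∑ b ∈ S, ‖c b‖ * ‖L b i j‖ := by
  rw [Matrix.sum_apply]
  refine (norm_sum_le _ _).trans (Finset.sum_le_sum fun b _ => ?_)
  rw [Matrix.smul_apply, smul_eq_mul, norm_mul]

/-- [folklore] (a) ENTRYWISE, complex momentum: `‖(F(p+iηa) − F(p)) i j‖ ≤ Σ_b |e^{−ηa·b} − 1|·‖cphase b p‖·‖L b i j‖`. -/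
theorem norm_imShift_sub_apply_le (p : Fin (d + 1) → ℂ) (η : ℝ) (a : Fin (d + 1) → ℝ) (i j : n) :
    ‖(trigPolySymbol S L (imShift p η a) - trigPolySymbol S L p) i j‖ ≤
      ∑ b ∈ S, |cw η a b - 1| * ‖cphase b p‖ * ‖L b i j‖ := by
  rw [trigPolySymbol_imShift_sub]
  refine (norm_sum_smul_apply_le S L _ i j).trans (le_of_eq (Finset.sum_congr rfl fun b _ => ?_))
  rw [norm_mul, Complex.norm_real, Real.norm_eq_abs]

/-- [folklore] (a) ENTRYWISE, real momentum, range `R`: `‖(F(q+iηa) − F(q)) i j‖ ≤ (e^{|η|R} − 1) Σ_b ‖L b i j‖`. -/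
theorem norm_imShift_sub_apply_le_of_real (q : Fin (d + 1) → ℝ) (η : ℝ) {a : Fin (d + 1) → ℝ} {R : ℝ}
    (hR : ∀ b ∈ S, |rdot a b| ≤ R) (i j : n) :
    ‖(trigPolySymbol S L (imShift (ofRealVec q) η a) - trigPolySymbol S L (ofRealVec q)) i j‖ ≤
      (Real.exp (|η| * R) - 1) * ∑ b ∈ S, ‖L b i j‖ := by
  refine (norm_imShift_sub_apply_le S L _ η a i j).trans ?_
  rw [Finset.mul_sum]
  refine Finset.sum_le_sum fun b hb => ?_
  rw [norm_cphase_ofRealVec, mul_one]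
  exact mul_le_mul_of_nonneg_right (abs_cw_sub_one_le (hR b hb)) (norm_nonneg _)

/-- [folklore] (a) ENTRYWISE SECOND ORDER, real momentum: `‖(F(q+iηa) − F(q) + η F₁(q)) i j‖ ≤ (e^{|η|R} − 1 − |η|R) Σ_b ‖L b i j‖`. -/
theorem norm_imShift_sub_add_apply_le_of_real (q : Fin (d + 1) → ℝ) (η : ℝ) {a : Fin (d + 1) → ℝ} {R : ℝ}
    (hR : ∀ b ∈ S, |rdot a b| ≤ R) (i j : n) :
    ‖(trigPolySymbol S L (imShift (ofRealVec q) η a) - trigPolySymbol S L (ofRealVec q) +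
        (η : ℂ) • firstOrder S L a (ofRealVec q)) i j‖ ≤
      (Real.exp (|η| * R) - 1 - |η| * R) * ∑ b ∈ S, ‖L b i j‖ := by
  rw [trigPolySymbol_imShift_sub_add_firstOrder, Finset.mul_sum]
  refine (norm_sum_smul_apply_le S L _ i j).trans (Finset.sum_le_sum fun b hb => ?_)
  rw [norm_mul, Complex.norm_real, Real.norm_eq_abs, norm_cphase_ofRealVec, mul_one]
  exact mul_le_mul_of_nonneg_right (abs_cw_sub_one_add_le (hR b hb)) (norm_nonneg _)

variable [Fintype n] [DecidableEq n]

/-- [folklore] generic Euclidean-operator bound for the weighted sums of this file, from operator bounds `‖L b‖ ≤ ℓ b`. -/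
theorem norm_toEuclideanLin_sum_smul_le (c : (Fin (d + 1) → ℤ) → ℂ) {ℓ : (Fin (d + 1) → ℤ) → ℝ}
    (hLb : ∀ b ∈ S, ∀ v : EuclideanSpace ℂ n, ‖toEuclideanLin (L b) v‖ ≤ ℓ b * ‖v‖) (v : EuclideanSpace ℂ n) :
    ‖toEuclideanLin (∑ b ∈ S, c b • L b) v‖ ≤ (∑ b ∈ S, ‖c b‖ * ℓ b) * ‖v‖ := by
  rw [map_sum, LinearMap.sum_apply, Finset.sum_mul]
  refine (norm_sum_le _ _).trans (Finset.sum_le_sum fun b hb => ?_)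
  rw [map_smul, LinearMap.smul_apply, norm_smul, mul_assoc]
  exact mul_le_mul_of_nonneg_left (hLb b hb v) (norm_nonneg _)

/-- [folklore] nonnegativity of `ℓ b · ‖v‖` under the operator bound. -/
theorem opBound_nonneg {M : Matrix n n ℂ} {ℓ : ℝ} (h : ∀ v : EuclideanSpace ℂ n, ‖toEuclideanLin M v‖ ≤ ℓ * ‖v‖)
    (v : EuclideanSpace ℂ n) : 0 ≤ ℓ * ‖v‖ := (norm_nonneg _).trans (h v)

/-- [folklore] **(a) OPERATOR FORM of the first difference bound** (real momentum, range `R`, `‖L b‖ ≤ ℓ b` in the `hH` currency of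
`SaddlePointBound.matrix_apriori`): `‖(F(q+iηa) − F(q)) v‖ ≤ (e^{|η|R} − 1)·(Σ_b ℓ b)·‖v‖`. -/
theorem norm_toEuclideanLin_imShift_sub_le (q : Fin (d + 1) → ℝ) (η : ℝ) {a : Fin (d + 1) → ℝ} {R : ℝ}
    (hR : ∀ b ∈ S, |rdot a b| ≤ R) {ℓ : (Fin (d + 1) → ℤ) → ℝ}
    (hLb : ∀ b ∈ S, ∀ v : EuclideanSpace ℂ n, ‖toEuclideanLin (L b) v‖ ≤ ℓ b * ‖v‖) (v : EuclideanSpace ℂ n) :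
    ‖toEuclideanLin (trigPolySymbol S L (imShift (ofRealVec q) η a) - trigPolySymbol S L (ofRealVec q)) v‖ ≤
      (Real.exp (|η| * R) - 1) * (∑ b ∈ S, ℓ b) * ‖v‖ := by
  rw [trigPolySymbol_imShift_sub]
  refine (norm_toEuclideanLin_sum_smul_le S L _ hLb v).trans ?_
  rw [Finset.mul_sum, Finset.sum_mul, Finset.sum_mul]
  refine Finset.sum_le_sum fun b hb => ?_
  rw [norm_mul, Complex.norm_real, Real.norm_eq_abs, norm_cphase_ofRealVec, mul_one, mul_assoc, mul_assoc]
  exact mul_le_mul_of_nonneg_right (abs_cw_sub_one_le (hR b hb)) (opBound_nonneg (hLb b hb) v)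

/-- [folklore] **(a) OPERATOR FORM of the second-order bound**: `‖(F(q+iηa) − F(q) + η F₁(q)) v‖ ≤ (e^{|η|R} − 1 − |η|R)·(Σ_b ℓ b)·‖v‖`. -/
theorem norm_toEuclideanLin_imShift_sub_add_le (q : Fin (d + 1) → ℝ) (η : ℝ) {a : Fin (d + 1) → ℝ} {R : ℝ}
    (hR : ∀ b ∈ S, |rdot a b| ≤ R) {ℓ : (Fin (d + 1) → ℤ) → ℝ}
    (hLb : ∀ b ∈ S, ∀ v : EuclideanSpace ℂ n, ‖toEuclideanLin (L b) v‖ ≤ ℓ b * ‖v‖) (v : EuclideanSpace ℂ n) :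
    ‖toEuclideanLin (trigPolySymbol S L (imShift (ofRealVec q) η a) - trigPolySymbol S L (ofRealVec q) +
        (η : ℂ) • firstOrder S L a (ofRealVec q)) v‖ ≤
      (Real.exp (|η| * R) - 1 - |η| * R) * (∑ b ∈ S, ℓ b) * ‖v‖ := by
  rw [trigPolySymbol_imShift_sub_add_firstOrder]
  refine (norm_toEuclideanLin_sum_smul_le S L _ hLb v).trans ?_
  rw [Finset.mul_sum, Finset.sum_mul, Finset.sum_mul]
  refine Finset.sum_le_sum fun b hb => ?_
  rw [norm_mul, Complex.norm_real, Real.norm_eq_abs, norm_cphase_ofRealVec, mul_one, mul_assoc, mul_assoc]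
  exact mul_le_mul_of_nonneg_right (abs_cw_sub_one_add_le (hR b hb)) (opBound_nonneg (hLb b hb) v)

end Bounds

/-! ## §4 Adjoints at real momentum under the stencil symmetry `(hS) (hL)` -/

/-- [folklore] re-indexing a sum over a NEGATION-SYMMETRIC displacement set by `b ↦ −b`. -/
theorem sum_neg_index {M : Type*} [AddCommMonoid M] {S : Finset (Fin (d + 1) → ℤ)} (hS : ∀ b ∈ S, -b ∈ S)
    (f : (Fin (d + 1) → ℤ) → M) : ∑ b ∈ S, f (-b) = ∑ b ∈ S, f b :=
  Finset.sum_nbij' (fun b => -b) (fun b => -b) (fun b hb => hS b hb) (fun b hb => hS b hb)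
    (fun b _ => neg_neg b) (fun b _ => neg_neg b) (fun _ _ => rfl)

/-- [folklore] at REAL momentum the conjugate character is the character of the opposite displacement. -/
theorem conj_cphase_ofRealVec (b : Fin (d + 1) → ℤ) (q : Fin (d + 1) → ℝ) :
    conj (cphase b (ofRealVec q)) = cphase (-b) (ofRealVec q) := by
  unfold cphase
  rw [← Complex.exp_conj, map_mul, Complex.conj_I, map_sum]
  congr 1
  rw [neg_mul, ← mul_neg, ← Finset.sum_neg_distrib]
  congr 1
  refine Finset.sum_congr rfl fun μ _ => ?_
  rw [map_mul, Pi.neg_apply, Int.cast_neg, mul_neg]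
  simp only [ofRealVec, Complex.conj_ofReal, ← Complex.ofReal_intCast]

section Adjoint

variable {n : Type*} {S : Finset (Fin (d + 1) → ℤ)} {L : (Fin (d + 1) → ℤ) → Matrix n n ℂ}

/-- [folklore] **(b) THE ADJOINT OF THE SHIFTED SYMBOL IS THE OPPOSITELY SHIFTED SYMBOL**: under `hS : b ∈ S → −b ∈ S` and `hL : L(−b) = (L b)ᴴ`,
`(F(q + iηa))ᴴ = F(q − iηa)` at every real momentum `q`. -/
theorem conjTranspose_trigPolySymbol_imShift (hS : ∀ b ∈ S, -b ∈ S) (hL : ∀ b ∈ S, L (-b) = (L b)ᴴ)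
    (q : Fin (d + 1) → ℝ) (η : ℝ) (a : Fin (d + 1) → ℝ) :
    (trigPolySymbol S L (imShift (ofRealVec q) η a))ᴴ = trigPolySymbol S L (imShift (ofRealVec q) (-η) a) := by
  rw [trigPolySymbol_imShift, trigPolySymbol_imShift, Matrix.conjTranspose_sum,
    ← sum_neg_index hS (fun b => (((cw (-η) a b : ℝ) : ℂ) * cphase b (ofRealVec q)) • L b)]
  refine Finset.sum_congr rfl fun b hb => ?_
  rw [Matrix.conjTranspose_smul, hL b hb, star_mul', Complex.star_def, Complex.conj_ofReal,
    conj_cphase_ofRealVec, cw_neg_right, neg_neg]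

/-- [folklore] **(b) THE SYMBOL IS HERMITIAN AT REAL MOMENTUM** under (hS) (hL). -/
theorem isHermitian_trigPolySymbol (hS : ∀ b ∈ S, -b ∈ S) (hL : ∀ b ∈ S, L (-b) = (L b)ᴴ) (q : Fin (d + 1) → ℝ) :
    (trigPolySymbol S L (ofRealVec q)).IsHermitian := by
  have h := conjTranspose_trigPolySymbol_imShift hS hL q 0 (fun _ => 0)
  rwa [neg_zero, imShift_zero] at h

/-- [folklore] **(b) THE FIRST-ORDER TERM IS ANTI-HERMITIAN AT REAL MOMENTUM**: `F₁(q)ᴴ = −F₁(q)` under (hS) (hL). -/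
theorem conjTranspose_firstOrder (hS : ∀ b ∈ S, -b ∈ S) (hL : ∀ b ∈ S, L (-b) = (L b)ᴴ) (a : Fin (d + 1) → ℝ)
    (q : Fin (d + 1) → ℝ) : (firstOrder S L a (ofRealVec q))ᴴ = -firstOrder S L a (ofRealVec q) := by
  unfold firstOrder
  rw [Matrix.conjTranspose_sum, ← Finset.sum_neg_distrib,
    ← sum_neg_index hS (fun b => -((((rdot a b : ℝ) : ℂ) * cphase b (ofRealVec q)) • L b))]
  refine Finset.sum_congr rfl fun b hb => ?_
  rw [Matrix.conjTranspose_smul, hL b hb, star_mul', Complex.star_def, Complex.conj_ofReal,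
    conj_cphase_ofRealVec, rdot_neg, ← neg_smul]
  congr 1
  push_cast
  ring

variable [Fintype n]

/-- [folklore] the form of the adjoint: `⟨x, Mᴴ x⟩ = conj ⟨x, M x⟩` (`⟨x, y⟩ = star x ⬝ᵥ y`). -/
theorem form_conjTranspose (M : Matrix n n ℂ) (x : n → ℂ) :
    star x ⬝ᵥ (Mᴴ *ᵥ x) = conj (star x ⬝ᵥ (M *ᵥ x)) := by
  rw [Matrix.dotProduct_mulVec, ← Matrix.star_mulVec, Matrix.star_dotProduct, Complex.star_def]

/-- [folklore] the real part of the form of an ANTI-HERMITIAN matrix vanishes. -/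
theorem re_form_eq_zero_of_conjTranspose_eq_neg {A : Matrix n n ℂ} (h : Aᴴ = -A) (x : n → ℂ) :
    (star x ⬝ᵥ (A *ᵥ x)).re = 0 := by
  have h1 := form_conjTranspose A x
  rw [h, Matrix.neg_mulVec, dotProduct_neg] at h1
  have h2 := congr_arg Complex.re h1
  rw [Complex.neg_re, Complex.conj_re] at h2
  linarith

/-- [folklore] **(b) THE FIRST-ORDER CONJUGATION ERROR COSTS NOTHING IN THE REAL PART OF THE FORM**: `re ⟨x, F₁(q) x⟩ = 0` under (hS) (hL). -/
theorem re_form_firstOrder_eq_zero (hS : ∀ b ∈ S, -b ∈ S) (hL : ∀ b ∈ S, L (-b) = (L b)ᴴ) (a : Fin (d + 1) → ℝ)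
    (q : Fin (d + 1) → ℝ) (x : n → ℂ) : (star x ⬝ᵥ (firstOrder S L a (ofRealVec q) *ᵥ x)).re = 0 :=
  re_form_eq_zero_of_conjTranspose_eq_neg (conjTranspose_firstOrder hS hL a q) x

end Adjoint

end Summit.QuantumFields.BalabanUV.Beta.GAN24.FibreSymbolShift

end
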